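import Mathlib
import Summits.PneNP.PneNP.Theses.OneSlice
import Summits.PneNP.PneNP.Theorems.OneSliceSliceTargetSplit
import Summits.PneNP.PneNP.Theorems.OneSliceSliceTargetSplitStability
import Summits.PneNP.PneNP.Theorems.OneSliceMonotoneContinuationDefs
import Summits.PneNP.PneNP.Theorems.OneSliceMonotoneContinuationSamplerBounds
import Summits.PneNP.PneNP.Theorems.OneSliceMonotoneContinuationChainConstancy
import Summits.PneNP.PneNP.Theorems.OneSliceMonotoneContinuationPadLanding

/-!
# Route OneSlice, crux `MonotoneContinuation` (stmt-PneNP-18471), line `Sketch_ideator1_r1` — bridge `MC → flat-above`,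
part 2: the padded votes on one slice

`ĝ = transport j (ind g₀)` is the transport of the slice function, `f'` the function of the continuation circuit, the
padded vote at `x` is `f' (x ∨ ρ)`, `ρ ∼ padLaw n A`.  Read from the base slice the average disagreement of the votes with
the slice function is EXACTLY `|𝟙[f'] - ĝ|` at the landing point (`votes_level_base`); read from an upper slice against
the rounded transport it costs in addition `2ĝ(1-ĝ)` and the rounding flips, which chain constancy
(`chain_constancy_down`) converts into `8·Σĝ(1-ĝ)` (`votes_slice_up`).  `padVote_error` splits the landing levels into a
good window (binomial weight `≥ bmin`, near-Booleanness `≤ nbB`) and a tail of landing mass `≤ δt`.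
-/

set_option linter.dupNamespace false -- `Summit.PneNP.PneNP.…`: summit = sub-problem (D-0017)

namespace Summit.PneNP.PneNP.Theorems.MonotoneContinuation

open Literature.Computability.Complexity hiding supp mem_supp
open Finset hiding slice
open Filter hiding mem_sdiff
open Classical
open Summit.PneNP.PneNP.Theorems (card_slice binomialWeight_tail_le binomialWeight_nonneg)
open Summit.PneNP.PneNP.Theorems.ConstantBand.Negative (Edge thr Central slice)
open Summit.PneNP.PneNP.Theorems.SingleThreshold.Negative (pc tendsto_pc)
open Summit.PneNP.PneNP.Theorems.SliceACZero.Negative (supp mem_supp card_supp)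
open Summit.PneNP.PneNP.Theorems.SliceTargetSplit (nbhd mem_nbhd transport ind l1 card_nbhd_of_le comp_iff_supp
  transport_ind_mem ind_nonneg ind_le_one l1_triangle l1_nonneg transport_nonneg rdist_eq_l1)

noncomputable section

variable {n : ℕ}

/-! ## Part 2 — the padded votes on one slice

Throughout, `ĝ = transport j (ind g₀)` is the transport of the slice function, `f'` is the Boolean function of the
continuation circuit `C'` (close to `ĝ` in `L¹(G(n,p))`), and the padded vote at `x` is `f' (x ∨ ρ)`, `ρ ∼ padLaw n A`.
-/

/-- Rounding a number of `[0,1]` at `1/2` moves it by at most `2 t (1 - t)`. -/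
theorem votes_abs_sub_round_le {t : ℝ} (ht0 : 0 ≤ t) (ht1 : t ≤ 1) :
    |t - (if (1 : ℝ) / 2 ≤ t then 1 else 0)| ≤ 2 * (t * (1 - t)) := by
  split_ifs with h
  · rw [abs_le]; constructor <;> nlinarith
  · push Not at h
    rw [abs_le]; constructor <;> nlinarith

/-- `min t (1-t) ≤ 2 t (1-t)` on `[0,1]`. -/
theorem votes_min_le {t : ℝ} (ht0 : 0 ≤ t) (ht1 : t ≤ 1) : min t (1 - t) ≤ 2 * (t * (1 - t)) := by
  rcases le_or_gt t (1 / 2) with h | h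
  · rw [min_eq_left (by linarith)]; nlinarith
  · rw [min_eq_right (by linarith)]; nlinarith

/-- `t (1 - t) ≤ |b - t|` for a bit `b` and `t ∈ [0,1]`: near-Booleanness is controlled by the distance to ANY
Boolean function. -/
theorem votes_mul_one_sub_le_abs {t : ℝ} (ht0 : 0 ≤ t) (ht1 : t ≤ 1) (b : Bool) :
    t * (1 - t) ≤ |(if b = true then (1 : ℝ) else 0) - t| := by
  cases b
  · simp only [Bool.false_eq_true, ↓reduceIte, zero_sub, abs_neg]
    rw [abs_of_nonneg ht0]; nlinarith
  · simp only [↓reduceIte]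
    rw [abs_of_nonneg (by linarith)]; nlinarith

/-- Convexity: `|Σ_ρ w(ρ) F(ρ) - G| ≤ Σ_ρ w(ρ) |F(ρ) - G|` for a probability vector `w`. -/
theorem votes_abs_avg_sub_le (w F : (Edge n → Bool) → ℝ) (hw : ∀ ρ, 0 ≤ w ρ) (hw1 : ∑ ρ, w ρ = 1) (G : ℝ) :
    |∑ ρ, w ρ * F ρ - G| ≤ ∑ ρ, w ρ * |F ρ - G| := by
  have h : ∑ ρ, w ρ * F ρ - G = ∑ ρ, w ρ * (F ρ - G) := by
    simp_rw [mul_sub]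
    rw [sum_sub_distrib, ← sum_mul, hw1, one_mul]
  rw [h]
  refine (abs_sum_le_sum_abs _ _).trans (le_of_eq (sum_congr rfl fun ρ _ => ?_))
  rw [abs_mul, abs_of_nonneg (hw ρ)]

/-- **Votes read on the base slice.** For `y` above slice `j`, the `j`-subsets `x` of `y` see the constant vote `f' y`;
their average disagreement with the slice function is exactly `|𝟙[f' y] - ĝ(y)|`. -/
theorem votes_level_base (j : ℕ) (f' g₀ : (Edge n → Bool) → Bool) {y : Edge n → Bool} (hy : j ≤ edgeCount y) :
    ∑ x ∈ nbhd j y, |ind f' y - ind g₀ x| = #(nbhd j y) * |ind f' y - transport j (ind g₀) y| := by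
  have hpos : (0 : ℝ) < #(nbhd j y) := by
    rw [card_nbhd_of_le hy]; exact_mod_cast Nat.choose_pos hy
  have hT : ∑ x ∈ nbhd j y, ind g₀ x = #(nbhd j y) * transport j (ind g₀) y := by
    rw [transport, mul_div_cancel₀ _ hpos.ne']
  have hT0 := (transport_ind_mem (j := j) g₀ y).1
  have hT1 := (transport_ind_mem (j := j) g₀ y).2
  by_cases hf : f' y = true
  · have h1 : ∀ x ∈ nbhd j y, |ind f' y - ind g₀ x| = 1 - ind g₀ x := by
      intro x _
      rw [ind, if_pos hf, abs_of_nonneg (by linarith [ind_le_one g₀ x])]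
    rw [sum_congr rfl h1, sum_sub_distrib, sum_const, nsmul_eq_mul, mul_one, hT, ind, if_pos hf,
      abs_of_nonneg (by linarith)]
    ring
  · have h1 : ∀ x ∈ nbhd j y, |ind f' y - ind g₀ x| = ind g₀ x := by
      intro x _
      rw [ind, if_neg hf, zero_sub, abs_neg, abs_of_nonneg (ind_nonneg g₀ x)]
    rw [sum_congr rfl h1, hT, ind, if_neg hf, zero_sub, abs_neg, abs_of_nonneg hT0]

/-- **Votes read on an upper slice.** For `y` above slice `i ≥ j` and the rounded transport `rnd = 𝟙[ĝ ≥ 1/2]` as the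
reference on slice `i`: the `i`-subsets `x` of `y` disagree with the vote `f' y` on average by at most
`|𝟙[f' y] - ĝ(y)| + 2 ĝ(y)(1 - ĝ(y))` plus the fraction of `x` whose rounding differs from that of `y`. -/
theorem votes_level_up (j i : ℕ) (f' g₀ : (Edge n → Bool) → Bool) {y : Edge n → Bool} (hy : i ≤ edgeCount y) :
    ∑ x ∈ nbhd i y, |ind f' y - ind (fun u => decide ((1 : ℝ) / 2 ≤ transport j (ind g₀) u)) x| ≤
      #(nbhd i y) * (|ind f' y - transport j (ind g₀) y| +
        2 * (transport j (ind g₀) y * (1 - transport j (ind g₀) y))) +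
      #((nbhd i y).filter fun u => decide ((1 : ℝ) / 2 ≤ transport j (ind g₀) u) ≠
        decide ((1 : ℝ) / 2 ≤ transport j (ind g₀) y)) := by
  set T := transport j (ind g₀) with hTdef
  set rnd : (Edge n → Bool) → Bool := fun u => decide ((1 : ℝ) / 2 ≤ T u) with hrnd
  have hT0 := (transport_ind_mem (j := j) g₀ y).1
  have hT1 := (transport_ind_mem (j := j) g₀ y).2
  have hround : |T y - ind rnd y| ≤ 2 * (T y * (1 - T y)) := by
    have : ind rnd y = if (1 : ℝ) / 2 ≤ T y then 1 else 0 := by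
      simp only [ind, hrnd, decide_eq_true_eq]
    rw [this]; exact votes_abs_sub_round_le hT0 hT1
  have hpt : ∀ x ∈ nbhd i y, |ind f' y - ind rnd x| ≤
      (|ind f' y - T y| + 2 * (T y * (1 - T y))) + (if rnd x ≠ rnd y then 1 else 0) := by
    intro x _
    have hflip : |ind rnd y - ind rnd x| ≤ (if rnd x ≠ rnd y then 1 else 0) := by
      by_cases h : rnd x = rnd y
      · rw [if_neg (not_not.2 h), ind, ind, h, sub_self, abs_zero]
      · rw [if_pos h]
        have := ind_nonneg rnd x; have := ind_le_one rnd x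
        have := ind_nonneg rnd y; have := ind_le_one rnd y
        rw [abs_le]; constructor <;> linarith
    calc |ind f' y - ind rnd x| ≤ |ind f' y - T y| + |T y - ind rnd y| + |ind rnd y - ind rnd x| := by
          have := abs_sub_le (ind f' y) (T y) (ind rnd x)
          have := abs_sub_le (T y) (ind rnd y) (ind rnd x)
          linarith
      _ ≤ _ := by linarith
  refine (sum_le_sum hpt).trans (le_of_eq ?_)
  rw [sum_add_distrib, sum_const, nsmul_eq_mul, ← sum_filter, sum_const, nsmul_eq_mul, mul_one, card_nbhd_of_le hy]

/-- **Level sums of the votes, base slice**: with slack for the (absent) rounding terms. -/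
theorem votes_slice_base (j s : ℕ) (hjs : j ≤ s) (f' g₀ : (Edge n → Bool) → Bool) :
    ∑ y ∈ slice n s, ∑ x ∈ nbhd j y, |ind f' y - ind g₀ x| ≤
      (s.choose j : ℝ) * ∑ y ∈ slice n s, (|ind f' y - transport j (ind g₀) y| +
        10 * (transport j (ind g₀) y * (1 - transport j (ind g₀) y))) := by
  rw [mul_sum]
  refine sum_le_sum fun y hy => ?_
  have hy' : edgeCount y = s := (mem_filter.1 hy).2
  rw [votes_level_base j f' g₀ (by omega), card_nbhd_of_le (by omega), hy']
  have hT0 := (transport_ind_mem (j := j) g₀ y).1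
  have hT1 := (transport_ind_mem (j := j) g₀ y).2
  have h0 : (0 : ℝ) ≤ (s.choose j : ℝ) := Nat.cast_nonneg _
  have hq : 0 ≤ transport j (ind g₀) y * (1 - transport j (ind g₀) y) := mul_nonneg hT0 (by linarith)
  nlinarith [abs_nonneg (ind f' y - transport j (ind g₀) y)]

/-- **Level sums of the votes, upper slice** (`j ≤ i ≤ s ≤ N`): chain constancy (`chain_constancy_down`) converts the
rounding-flip fraction into `8 · Σ ĝ(1-ĝ)`. -/
theorem votes_slice_up (j i s : ℕ) (hji : j ≤ i) (his : i ≤ s) (hs : s ≤ n.choose 2) (f' g₀ : (Edge n → Bool) → Bool) :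
    ∑ y ∈ slice n s, ∑ x ∈ nbhd i y, |ind f' y - ind (fun u => decide ((1 : ℝ) / 2 ≤ transport j (ind g₀) u)) x| ≤
      (s.choose i : ℝ) * ∑ y ∈ slice n s, (|ind f' y - transport j (ind g₀) y| +
        10 * (transport j (ind g₀) y * (1 - transport j (ind g₀) y))) := by
  set T := transport j (ind g₀) with hTdef
  have hcc := chain_constancy_down n j i s g₀ hji his hs
  -- on slice `s` the denominators `#(nbhd i y)` all equal `C(s,i) > 0`
  have hden : ∀ y ∈ slice n s, (#(nbhd i y) : ℝ) = (s.choose i : ℝ) := by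
    intro y hy
    have hy' : edgeCount y = s := (mem_filter.1 hy).2
    rw [card_nbhd_of_le (by omega), hy']
  have hCpos : (0 : ℝ) < (s.choose i : ℝ) := by exact_mod_cast Nat.choose_pos his
  have hflips : ∑ y ∈ slice n s, (#((nbhd i y).filter fun u => decide ((1 : ℝ) / 2 ≤ T u) ≠
      decide ((1 : ℝ) / 2 ≤ T y)) : ℝ) ≤ (s.choose i : ℝ) * (4 * ∑ y ∈ slice n s, min (T y) (1 - T y)) := by
    have h1 : ∑ y ∈ slice n s, (#((nbhd i y).filter fun u => decide ((1 : ℝ) / 2 ≤ T u) ≠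
        decide ((1 : ℝ) / 2 ≤ T y)) : ℝ) =
        (s.choose i : ℝ) * ∑ y ∈ slice n s, (#((nbhd i y).filter fun u => decide ((1 : ℝ) / 2 ≤ T u) ≠
          decide ((1 : ℝ) / 2 ≤ T y)) : ℝ) / #(nbhd i y) := by
      rw [mul_sum]
      refine sum_congr rfl fun y hy => ?_
      rw [hden y hy, mul_div_cancel₀ _ hCpos.ne']
    rw [h1]
    exact mul_le_mul_of_nonneg_left hcc hCpos.le
  have hmin : ∑ y ∈ slice n s, min (T y) (1 - T y) ≤ 2 * ∑ y ∈ slice n s, T y * (1 - T y) := by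
    rw [mul_sum]
    exact sum_le_sum fun y _ => votes_min_le (transport_ind_mem (j := j) g₀ y).1 (transport_ind_mem (j := j) g₀ y).2
  have hup : ∀ y ∈ slice n s, ∑ x ∈ nbhd i y, |ind f' y - ind (fun u => decide ((1 : ℝ) / 2 ≤ T u)) x| ≤
      (s.choose i : ℝ) * (|ind f' y - T y| + 2 * (T y * (1 - T y))) +
      #((nbhd i y).filter fun u => decide ((1 : ℝ) / 2 ≤ T u) ≠ decide ((1 : ℝ) / 2 ≤ T y)) := by
    intro y hy
    have := votes_level_up j i f' g₀ (y := y) (by rw [(mem_filter.1 hy).2]; exact his)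
    rwa [hden y hy] at this
  calc ∑ y ∈ slice n s, ∑ x ∈ nbhd i y, |ind f' y - ind (fun u => decide ((1 : ℝ) / 2 ≤ T u)) x|
      ≤ ∑ y ∈ slice n s, ((s.choose i : ℝ) * (|ind f' y - T y| + 2 * (T y * (1 - T y))) +
          #((nbhd i y).filter fun u => decide ((1 : ℝ) / 2 ≤ T u) ≠ decide ((1 : ℝ) / 2 ≤ T y))) := sum_le_sum hup
    _ = (s.choose i : ℝ) * ∑ y ∈ slice n s, (|ind f' y - T y| + 2 * (T y * (1 - T y))) +
          ∑ y ∈ slice n s, (#((nbhd i y).filter fun u => decide ((1 : ℝ) / 2 ≤ T u) ≠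
            decide ((1 : ℝ) / 2 ≤ T y)) : ℝ) := by rw [sum_add_distrib, mul_sum]
    _ ≤ (s.choose i : ℝ) * ∑ y ∈ slice n s, (|ind f' y - T y| + 2 * (T y * (1 - T y))) +
          (s.choose i : ℝ) * (4 * (2 * ∑ y ∈ slice n s, T y * (1 - T y))) := by
        have : (s.choose i : ℝ) * (4 * ∑ y ∈ slice n s, min (T y) (1 - T y)) ≤
            (s.choose i : ℝ) * (4 * (2 * ∑ y ∈ slice n s, T y * (1 - T y))) :=
          mul_le_mul_of_nonneg_left (by linarith) hCpos.le
        linarith [hflips]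
    _ = (s.choose i : ℝ) * ∑ y ∈ slice n s, (|ind f' y - T y| + 10 * (T y * (1 - T y))) := by
        have : ∑ y ∈ slice n s, (|ind f' y - T y| + 10 * (T y * (1 - T y))) =
            ∑ y ∈ slice n s, (|ind f' y - T y| + 2 * (T y * (1 - T y))) +
              4 * (2 * ∑ y ∈ slice n s, T y * (1 - T y)) := by
          rw [mul_sum, mul_sum, ← sum_add_distrib]
          exact sum_congr rfl fun y _ => by ring
        rw [this]; ring

/-- The `L¹(G(n,p))` distance as a binomial average of level averages. -/
theorem votes_l1_eq (p : ℝ) (u v : (Edge n → Bool) → ℝ) :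
    l1 n p u v = ∑ s ∈ range (n.choose 2 + 1), binW (n.choose 2) p s * ((∑ y ∈ slice n s, |u y - v y|) / #(slice n s)) := by
  unfold l1
  have h := sum_eq_sum_slices (n := n) p (fun _ => (1 : ℝ)) (fun y => |u y - v y|)
  simp_rw [mul_one] at h
  rw [h]
  refine sum_congr rfl fun s hs => ?_
  have hsN : s ≤ n.choose 2 := Nat.lt_succ_iff.1 (mem_range.1 hs)
  have hpos : (0 : ℝ) < #(slice n s) := by exact_mod_cast card_slice_pos hsN
  have hC : (((n.choose 2).choose s : ℕ) : ℝ) ≠ 0 := by exact_mod_cast (Nat.choose_pos hsN).ne'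
  rw [binW, card_slice]
  field_simp

/-- **The padded votes on one slice.** Let `i ≥ j`, `A` a size window inside the cube, and suppose the level sums of
the disagreement `|𝟙[f' y] - Gref x|` over pairs `x ⊆ y` (`x` on slice `i`, `y` on the landing level) are controlled as
in `votes_slice_base` / `votes_slice_up`.  Split the landing levels into good ones — where the binomial weight is at
least `bmin` and the near-Booleanness `Σ ĝ(1-ĝ)` is at most `nbB` per point — and the rest, of landing mass `≤ δt`.
Then the slice-`i` sum of `|U(x) - Gref(x)|`, `U(x) = E_ρ 𝟙[f'(x ∨ ρ)]`, is at most
`#slice_i · (K_A/bmin · ‖𝟙[f'] - ĝ‖₁ + 10 nbB + (7/2) δt)`, `K_A = (N+1)/((N+1-i) #A)`. -/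
theorem padVote_error {p : ℝ} (hp0 : 0 ≤ p) (hp1 : p ≤ 1) {j i : ℕ} (hiN : i ≤ n.choose 2)
    {A : Finset ℕ} (hA : A.Nonempty) (hAN : ∀ a ∈ A, a ≤ n.choose 2)
    (f' g₀ : (Edge n → Bool) → Bool) (Gref : (Edge n → Bool) → ℝ)
    (hlevel : ∀ l ∈ range (n.choose 2 - i + 1),
      ∑ y ∈ slice n (i + l), ∑ x ∈ nbhd i y, |ind f' y - Gref x| ≤
        ((i + l).choose i : ℝ) * ∑ y ∈ slice n (i + l), (|ind f' y - transport j (ind g₀) y| +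
          10 * (transport j (ind g₀) y * (1 - transport j (ind g₀) y))))
    (Good : Finset ℕ) {bmin nbB δt : ℝ} (hbmin : 0 < bmin) (hnbB : 0 ≤ nbB)
    (hb : ∀ s ∈ Good, s ≤ n.choose 2 → bmin ≤ binW (n.choose 2) p s)
    (hnb : ∀ s ∈ Good, s ≤ n.choose 2 →
      ∑ y ∈ slice n s, transport j (ind g₀) y * (1 - transport j (ind g₀) y) ≤ #(slice n s) * nbB)
    (htail : ∑ l ∈ (range (n.choose 2 - i + 1)).filter (fun l => i + l ∉ Good), landW n i A l ≤ δt) :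
    ∑ x ∈ slice n i, |∑ ρ, padLaw n A ρ * ind f' (fun e => x e || ρ e) - Gref x| ≤
      #(slice n i) * ((((n.choose 2 : ℝ) + 1) / ((n.choose 2 : ℝ) - i + 1)) / #A / bmin *
        l1 n p (ind f') (transport j (ind g₀)) + 10 * nbB + 7 / 2 * δt) := by
  set N := n.choose 2 with hN
  set T := transport j (ind g₀) with hTdef
  set KA : ℝ := (((N : ℝ) + 1) / ((N : ℝ) - i + 1)) / #A with hKA
  have hsi : (0 : ℝ) < #(slice n i) := by exact_mod_cast card_slice_pos hiN
  have hKA0 : 0 ≤ KA := by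
    have : (0 : ℝ) < (N : ℝ) - i + 1 := by
      have : (i : ℝ) ≤ N := by exact_mod_cast hiN
      linarith
    rw [hKA]; positivity
  -- level averages of the two error densities
  set E : ℕ → ℝ := fun s => (∑ y ∈ slice n s, |ind f' y - T y|) / #(slice n s) with hE
  set Q : ℕ → ℝ := fun s => (∑ y ∈ slice n s, T y * (1 - T y)) / #(slice n s) with hQ
  have hE0 : ∀ s, 0 ≤ E s := fun s => div_nonneg (sum_nonneg fun y _ => abs_nonneg _) (Nat.cast_nonneg _)
  have hQ0 : ∀ s, 0 ≤ Q s := fun s => div_nonneg (sum_nonneg fun y _ =>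
    mul_nonneg (transport_ind_mem (j := j) g₀ y).1 (by linarith [(transport_ind_mem (j := j) g₀ y).2])) (Nat.cast_nonneg _)
  have hE1 : ∀ s, E s ≤ 1 := by
    intro s
    rcases Nat.eq_zero_or_pos #(slice n s) with h0 | hpos
    · simp only [hE, h0, Nat.cast_zero, div_zero]; norm_num
    · rw [hE, div_le_one (by exact_mod_cast hpos)]
      calc ∑ y ∈ slice n s, |ind f' y - T y| ≤ ∑ _y ∈ slice n s, (1 : ℝ) := by
            refine sum_le_sum fun y _ => ?_
            have := ind_nonneg f' y; have := ind_le_one f' y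
            have := (transport_ind_mem (j := j) g₀ y).1; have := (transport_ind_mem (j := j) g₀ y).2
            rw [abs_le]; constructor <;> linarith
        _ = #(slice n s) := by rw [sum_const, nsmul_eq_mul, mul_one]
  have hQ1 : ∀ s, Q s ≤ 1 / 4 := by
    intro s
    rcases Nat.eq_zero_or_pos #(slice n s) with h0 | hpos
    · simp only [hQ, h0, Nat.cast_zero, div_zero]; norm_num
    · rw [hQ, div_le_iff₀ (by exact_mod_cast hpos)]
      calc ∑ y ∈ slice n s, T y * (1 - T y) ≤ ∑ _y ∈ slice n s, (1 / 4 : ℝ) := by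
            refine sum_le_sum fun y _ => ?_
            nlinarith [(transport_ind_mem (j := j) g₀ y).1, sq_nonneg (T y - 1 / 2)]
        _ = 1 / 4 * #(slice n s) := by rw [sum_const, nsmul_eq_mul, mul_comm]
  -- step 1: convexity and regrouping
  set ψ : ℕ → ℝ := fun l => E (i + l) + 10 * Q (i + l) with hψ
  have hψlevel : ∀ l ∈ range (N - i + 1),
      ∑ y ∈ slice n (i + l), ∑ x ∈ nbhd i y, |ind f' y - Gref x| ≤ ((i + l).choose i : ℝ) * #(slice n (i + l)) * ψ l := by
    intro l hl
    have hl' : i + l ≤ N := by have := mem_range.1 hl; omega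
    have hpos : (0 : ℝ) < #(slice n (i + l)) := by exact_mod_cast card_slice_pos hl'
    refine (hlevel l hl).trans (le_of_eq ?_)
    simp only [hψ, hE, hQ]
    rw [sum_add_distrib, ← mul_sum]
    field_simp
  have hstep1 : ∑ x ∈ slice n i, |∑ ρ, padLaw n A ρ * ind f' (fun e => x e || ρ e) - Gref x| ≤
      #(slice n i) * ∑ l ∈ range (N - i + 1), landW n i A l * ψ l := by
    calc ∑ x ∈ slice n i, |∑ ρ, padLaw n A ρ * ind f' (fun e => x e || ρ e) - Gref x|
        ≤ ∑ x ∈ slice n i, ∑ ρ, padLaw n A ρ * |ind f' (fun e => x e || ρ e) - Gref x| :=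
          sum_le_sum fun x _ => votes_abs_avg_sub_le (padLaw n A) _ (padLaw_nonneg A) (padLaw_sum hA hAN) _
      _ ≤ _ := padSum_le hiN A (fun x y => |ind f' y - Gref x|) ψ hψlevel
  -- step 2: split the landing levels
  have hgood : ∀ l ∈ (range (N - i + 1)).filter (fun l => i + l ∈ Good),
      landW n i A l * ψ l ≤ KA / bmin * (binW N p (i + l) * E (i + l)) + landW n i A l * (10 * nbB) := by
    intro l hl
    have hl' : i + l ≤ N := by have := mem_range.1 (mem_filter.1 hl).1; omega
    have hG : i + l ∈ Good := (mem_filter.1 hl).2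
    have hW0 := landW_nonneg (n := n) i A l
    have hWle : landW n i A l ≤ KA := landW_le hiN hA hAN hl'
    have hbl : bmin ≤ binW N p (i + l) := hb _ hG hl'
    have hQl : Q (i + l) ≤ nbB := by
      have hpos : (0 : ℝ) < #(slice n (i + l)) := by exact_mod_cast card_slice_pos hl'
      rw [hQ, div_le_iff₀ hpos, mul_comm]; exact hnb _ hG hl'
    have h1 : landW n i A l * E (i + l) ≤ KA / bmin * (binW N p (i + l) * E (i + l)) := by
      calc landW n i A l * E (i + l) ≤ KA * E (i + l) := mul_le_mul_of_nonneg_right hWle (hE0 _)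
        _ = KA / bmin * (bmin * E (i + l)) := by field_simp
        _ ≤ KA / bmin * (binW N p (i + l) * E (i + l)) :=
            mul_le_mul_of_nonneg_left (mul_le_mul_of_nonneg_right hbl (hE0 _)) (div_nonneg hKA0 hbmin.le)
    have h2 : landW n i A l * (10 * Q (i + l)) ≤ landW n i A l * (10 * nbB) :=
      mul_le_mul_of_nonneg_left (by linarith) hW0
    calc landW n i A l * ψ l = landW n i A l * E (i + l) + landW n i A l * (10 * Q (i + l)) := by
          simp only [hψ]; ring
      _ ≤ _ := add_le_add h1 h2
  have hbad : ∀ l ∈ (range (N - i + 1)).filter (fun l => i + l ∉ Good), landW n i A l * ψ l ≤ landW n i A l * (7 / 2) := by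
    intro l _
    refine mul_le_mul_of_nonneg_left ?_ (landW_nonneg i A l)
    simp only [hψ]; linarith [hE1 (i + l), hQ1 (i + l)]
  have hsplit : ∑ l ∈ range (N - i + 1), landW n i A l * ψ l ≤ KA / bmin * l1 n p (ind f') T + 10 * nbB + 7 / 2 * δt := by
    rw [← sum_filter_add_sum_filter_not (range (N - i + 1)) (fun l => i + l ∈ Good)]
    have hG := sum_le_sum hgood
    have hB := sum_le_sum hbad
    rw [sum_add_distrib, ← mul_sum, ← sum_mul] at hG
    rw [← sum_mul] at hB
    -- the good binomial sum is part of `l1`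
    have hl1 : ∑ l ∈ (range (N - i + 1)).filter (fun l => i + l ∈ Good), binW N p (i + l) * E (i + l) ≤ l1 n p (ind f') T := by
      rw [votes_l1_eq]
      -- reindex `l ↦ i + l` into `range (N + 1)`
      have hinj : ∀ l ∈ (range (N - i + 1)).filter (fun l => i + l ∈ Good), i + l ∈ range (N + 1) := by
        intro l hl; have := mem_range.1 (mem_filter.1 hl).1; rw [mem_range]; omega
      calc ∑ l ∈ (range (N - i + 1)).filter (fun l => i + l ∈ Good), binW N p (i + l) * E (i + l)
          = ∑ s ∈ ((range (N - i + 1)).filter (fun l => i + l ∈ Good)).image (fun l => i + l), binW N p s * E s := by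
            rw [sum_image]
            intro a _ b _ hab
            simp only at hab
            omega
        _ ≤ ∑ s ∈ range (N + 1), binW N p s * E s := by
            refine sum_le_sum_of_subset_of_nonneg ?_ fun s _ _ => mul_nonneg (binW_nonneg hp0 hp1 s) (hE0 s)
            intro s hs
            obtain ⟨l, hl, rfl⟩ := mem_image.1 hs
            exact hinj l hl
    have hmass : ∑ l ∈ (range (N - i + 1)).filter (fun l => i + l ∈ Good), landW n i A l ≤ 1 := by
      calc ∑ l ∈ (range (N - i + 1)).filter (fun l => i + l ∈ Good), landW n i A l
          ≤ ∑ l ∈ range (N - i + 1), landW n i A l :=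
            sum_le_sum_of_subset_of_nonneg (filter_subset _ _) fun l _ _ => landW_nonneg i A l
        _ = 1 := landW_sum hiN hA hAN
    have h1 : KA / bmin * (∑ l ∈ (range (N - i + 1)).filter (fun l => i + l ∈ Good), binW N p (i + l) * E (i + l)) ≤
        KA / bmin * l1 n p (ind f') T :=
      mul_le_mul_of_nonneg_left hl1 (div_nonneg hKA0 hbmin.le)
    have h2 : (∑ l ∈ (range (N - i + 1)).filter (fun l => i + l ∈ Good), landW n i A l) * (10 * nbB) ≤ 10 * nbB := by
      have : 0 ≤ 10 * nbB := by linarith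
      nlinarith [hmass, sum_nonneg fun l (_ : l ∈ (range (N - i + 1)).filter (fun l => i + l ∈ Good)) => landW_nonneg (n := n) i A l]
    have h3 : (∑ l ∈ (range (N - i + 1)).filter (fun l => i + l ∉ Good), landW n i A l) * (7 / 2) ≤ 7 / 2 * δt := by
      nlinarith [htail]
    linarith [hG, hB, h1, h2, h3]
  calc ∑ x ∈ slice n i, |∑ ρ, padLaw n A ρ * ind f' (fun e => x e || ρ e) - Gref x|
      ≤ #(slice n i) * ∑ l ∈ range (N - i + 1), landW n i A l * ψ l := hstep1
    _ ≤ #(slice n i) * (KA / bmin * l1 n p (ind f') T + 10 * nbB + 7 / 2 * δt) :=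
        mul_le_mul_of_nonneg_left hsplit hsi.le


/-! ## Registered form -/

/-- **The padded votes on one slice** (registered sub-goal `padVotes` of stmt-PneNP-18471), written out. [folklore] -/
theorem padVotes :
  ∀ (n : ℕ) (p : ℝ), 0 ≤ p → p ≤ 1 → ∀ (j i : ℕ), i ≤ n.choose 2 → ∀ (A : Finset ℕ), A.Nonempty → (∀ a ∈ A, a ≤ n.choose 2) →
    ∀ (f' g₀ : (Edge n → Bool) → Bool) (Gref : (Edge n → Bool) → ℝ),
    (∀ l ∈ range (n.choose 2 - i + 1),
      ∑ y ∈ slice n (i + l), ∑ x ∈ nbhd i y, |ind f' y - Gref x| ≤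
        ((i + l).choose i : ℝ) * ∑ y ∈ slice n (i + l), (|ind f' y - transport j (ind g₀) y| +
          10 * (transport j (ind g₀) y * (1 - transport j (ind g₀) y)))) →
    ∀ (Good : Finset ℕ) (bmin nbB δt : ℝ), 0 < bmin → 0 ≤ nbB →
    (∀ s ∈ Good, s ≤ n.choose 2 → bmin ≤ binW (n.choose 2) p s) →
    (∀ s ∈ Good, s ≤ n.choose 2 →
      ∑ y ∈ slice n s, transport j (ind g₀) y * (1 - transport j (ind g₀) y) ≤ #(slice n s) * nbB) →
    (∑ l ∈ (range (n.choose 2 - i + 1)).filter (fun l => i + l ∉ Good), landW n i A l ≤ δt) →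
    ∑ x ∈ slice n i, |∑ ρ, padLaw n A ρ * ind f' (fun e => x e || ρ e) - Gref x| ≤
      #(slice n i) * ((((n.choose 2 : ℝ) + 1) / ((n.choose 2 : ℝ) - i + 1)) / #A / bmin *
        l1 n p (ind f') (transport j (ind g₀)) + 10 * nbB + 7 / 2 * δt) :=
  fun _ _ hp0 hp1 _ _ hiN _ hA hAN f' g₀ Gref hlevel Good _ _ _ hbmin hnbB hb hnb htail =>
    padVote_error hp0 hp1 hiN hA hAN f' g₀ Gref hlevel Good hbmin hnbB hb hnb htail

end

end Summit.PneNP.PneNP.Theorems.MonotoneContinuation
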